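import Summits.BirchSwinnertonDyer.BirchSwinnertonDyer.Theorems.KolyvaginRankRigidityAtTwoRegularRefillLaw
import HarnessLib

/-!
# Crux U1 `KolyvaginBoundedDefectAtTwo` (stmt-BirchSwinnertonDyer-28083), LINE 17 `regular_core_rigidity` v3,
# stub S1b `stub_nearCoreExistenceAtTwo` — a sign-free NEAR-CORE vertex is a COUNTING condition:
# «a class of order `2^M` survives and `#H ≤ 2^(M+κ)`» ⟹ «`2^κ · H ⊆ ℤx`»

Width seat `bsd-line-krr2-p2` g13 (ONE READER on S1b); `--supports stmt-BirchSwinnertonDyer-28083` (helper). PURE ALGEBRA;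
nothing here proves S1b, U1, a rung or BSD. BSD is NOT proved.

The registered stub S1b asks, at every level `M`, for a conductor `n` such that `H = H_{𝓕(n)}(K, E[2^M])` (the tree's
`Jetchev2008.modifiedSelmerGroup W K ι 2^M n`) contains `x` with `addOrderOf x = 2^M` and `∀ y ∈ H, ∃ t, 2^κ • y = t • x`
(inlined body of the pen's `IsNearCoreAt W K ι κ M n`). This file records that the second clause is implied by the SIZE
bound `#H ≤ 2^(M+κ)` once the survivor `x` of order `2^M` is there (`H` being killed by `2^M`): the quotient `H/ℤx` has
order `≤ 2^κ` and exponent a power of `2`, so `2^κ` kills it. Hence the walk of the reader report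
(`S1-READER-g13.md` §3–§4; refill law `RegularRefill.lozenge_refill`, p671760) only has to CUT `#H_{𝓕(n)}` down to
`2^(M+κ)` while keeping one class of order `2^M` alive — a statement about orders, which is the currency of the
Čebotarev engine (`exists_regular_kolyvaginPrime_of_heegner`: prescribed exact local orders) and of the lozenge
inequalities (`JET.Section6.lozenge_negSide`, `RegularRefill.lozenge_refill`).
* `forall_exists_zsmul_eq_of_natCard_le` — the implication, for any subgroup `H` of an additive commutative group;
* `pow_dvd_natCard_of_mem` — the trivial direction `2^M ∣ #H` when a class of order `2^M` lies in `H`.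
References (locators only; no cited FACT is declared): [cite: MazurRubin2004, Def. 4.1.8, Cor. 4.1.9]
[cite: Howard2004HeegnerKolyvagin, §1.6]. Design: no definitions; axioms `propext`, `Classical.choice`, `Quot.sound`.
-/

set_option autoImplicit false
-- the Theorems namespace of this sub repeats the summit name by design (D-0017 nested layout)
set_option linter.dupNamespace false

noncomputable section

open scoped Classical

namespace Summit.BirchSwinnertonDyer.BirchSwinnertonDyer.Theorems.KolyvaginAtTwo.RegularRefill

variable {G : Type*} [AddCommGroup G]

/-- **Near-core from a size bound.** If `H ≤ G` is killed by `2^M`, contains `x` of order `2^M`, and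
`#H ≤ 2^(M+κ)`, then `2^κ • y ∈ ℤx` for every `y ∈ H` (i.e. `(x, H)` is a sign-free near-core vertex of error `κ` in
the sense of LINE 17's `IsNearCoreAt`). PROOF: in `Q = H/ℤx`, `#Q = #H/2^M ≤ 2^κ`; the class of `y` has order a power of
`2` (it divides `2^M`) dividing `#Q`, hence `≤ 2^κ`, hence dividing `2^κ`. [cite: MazurRubin2004, Def. 4.1.8] -/
theorem forall_exists_zsmul_eq_of_natCard_le (H : AddSubgroup G) [Finite H] (M κ : ℕ)
    (hH : ∀ y ∈ H, (2 ^ M : ℕ) • y = 0) {x : G} (hx : x ∈ H) (hordx : addOrderOf x = 2 ^ M)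
    (hcard : Nat.card H ≤ 2 ^ (M + κ)) :
    ∀ y ∈ H, ∃ t : ℤ, ((2 ^ κ : ℕ) : ℤ) • y = t • x := by
  intro y hy
  set x' : H := ⟨x, hx⟩ with hx'
  set y' : H := ⟨y, hy⟩ with hy'
  set Z : AddSubgroup H := AddSubgroup.zmultiples x' with hZ
  -- `#Z = 2^M`
  have hordx' : addOrderOf x' = 2 ^ M := by
    rw [← AddSubgroup.addOrderOf_coe x']; exact hordx
  have hcardZ : Nat.card Z = 2 ^ M := by rw [hZ, Nat.card_zmultiples, hordx']
  -- `#Q · 2^M = #H`, so `#Q ≤ 2^κ`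
  have hHQ : Nat.card H = Nat.card (H ⧸ Z) * Nat.card Z := AddSubgroup.card_eq_card_quotient_mul_card_addSubgroup Z
  have hQ : Nat.card (H ⧸ Z) ≤ 2 ^ κ := by
    have h2M : 0 < 2 ^ M := Nat.pos_of_ne_zero (pow_ne_zero M two_ne_zero)
    have : Nat.card (H ⧸ Z) * 2 ^ M ≤ 2 ^ κ * 2 ^ M := by
      rw [← hcardZ, ← hHQ, hcardZ, ← pow_add, add_comm]; exact hcard
    exact Nat.le_of_mul_le_mul_right this h2M
  -- the class of `y` has order `2^i` with `2^i ∣ #Q ≤ 2^κ`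
  haveI : Finite (H ⧸ Z) := inferInstance
  set q : H ⧸ Z := (y' : H ⧸ Z) with hq
  have hq2M : (2 ^ M) • q = 0 := by
    rw [hq, ← QuotientAddGroup.mk_nsmul]
    have : (2 ^ M) • y' = 0 := Subtype.ext (by rw [AddSubgroupClass.coe_nsmul, hH y hy]; rfl)
    rw [this, QuotientAddGroup.mk_zero]
  obtain ⟨i, hiM, hi⟩ := (Nat.dvd_prime_pow Nat.prime_two).mp (addOrderOf_dvd_of_nsmul_eq_zero hq2M)
  have hile : 2 ^ i ≤ 2 ^ κ :=
    (hi ▸ Nat.le_of_dvd Nat.card_pos (addOrderOf_dvd_natCard q)).trans hQ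
  have hiκ : i ≤ κ := (Nat.pow_le_pow_iff_right (by norm_num)).mp hile
  have hqκ : (2 ^ κ) • q = 0 := by
    apply addOrderOf_dvd_iff_nsmul_eq_zero.mp
    rw [hi]; exact Nat.pow_dvd_pow 2 hiκ
  -- so `2^κ • y' ∈ Z`
  have hmem : (2 ^ κ) • y' ∈ Z := by
    rw [← QuotientAddGroup.eq_zero_iff, QuotientAddGroup.mk_nsmul]; exact hqκ
  obtain ⟨t, ht⟩ := AddSubgroup.mem_zmultiples_iff.mp hmem
  refine ⟨t, ?_⟩
  have h := congrArg Subtype.val ht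
  simp only [AddSubgroupClass.coe_zsmul, AddSubgroupClass.coe_nsmul] at h
  rw [natCast_zsmul]
  exact h.symm

/-- The trivial direction: a subgroup containing a class of order `2^M` has `2^M ≤ #H` (indeed `2^M ∣ #H`).
[cite: MazurRubin2004, Def. 4.1.8] -/
theorem pow_dvd_natCard_of_mem (H : AddSubgroup G) [Finite H] (M : ℕ) {x : G} (hx : x ∈ H)
    (hordx : addOrderOf x = 2 ^ M) : 2 ^ M ∣ Nat.card H := by
  have h := addOrderOf_dvd_natCard (⟨x, hx⟩ : H)
  rwa [← AddSubgroup.addOrderOf_coe, AddSubgroup.coe_mk, hordx] at h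

end Summit.BirchSwinnertonDyer.BirchSwinnertonDyer.Theorems.KolyvaginAtTwo.RegularRefill

end
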